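import Literature.GroupTheory.SpecificGroups.PadicAffineGroup
import Literature.GroupTheory.Index.PadicGL2Congruence
import Literature.AnabelianGeometry.AbsoluteAnabelian.MLFGaloisTFGProofs
import Mathlib.RingTheory.ZMod.UnitsCyclic
import HarnessLib

/-!
# The `p`-adic affine group `Aff(ℤ_p)` is topologically finitely generated (`p` odd)

[SemiAnbd] §0 p.6 / Thm 3.7 (ii) use `Aff(ℤ_p) = ℤ_p ⋊ ℤ_pˣ` as the model vertex group of the
one-vertex witness; the arithmetic tower statements of §5 (Def 5.1 (i)(a), the characteristic open
cores of the Galois-level data) ask the vertex groups to be *topologically finitely generated*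
([AbsTopI] §0).  We PROVE this classical fact for odd `p`:

* `PadicAffine.isTopologicallyFinitelyGenerated_padicAffine` — for `p ≠ 2`, `Aff(ℤ_p)` is
  topologically generated by **two** elements.

Proof: by the tree's reduction to finite quotients
(`isTopologicallyFinitelyGenerated_of_forall_quotient`, [NSW] Thm 7.5.10) it suffices to generate
`Aff(ℤ_p)` modulo every open normal subgroup `U` by `2` elements; `U` contains a congruence level
`Γ_n = {(a, u) : a ≡ 0, u ≡ 1 (pⁿ)}` (`PadicAffine.exists_level_le`), and modulo `Γ_n` every
`(a, u)` agrees with `(m, 1) · (0, v)^k = (m, v^k)` where `m ≡ a (pⁿ)` is a natural number and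
`v ∈ ℤ_pˣ` lifts a generator of the cyclic group `(ℤ/pⁿ)ˣ` (`p` odd; Mathlib
`ZMod.isCyclic_units_of_prime_pow`, lifted by `GL2.unitsMap_toZModPow_surjective`); the
translation `(1, 1)` and the homothety `(0, v)` therefore generate modulo `Γ_n ≤ U`.
(`p = 2` is left out: `(ℤ/2ⁿ)ˣ` is not cyclic for `n ≥ 3`; three generators would be needed.)

References: [SemiAnbd] = Mochizuki, *Semi-graphs of anabelioids*, Publ. RIMS 42 (2006), §0 p.6;
[NSW] = Neukirch–Schmidt–Wingberg, *Cohomology of Number Fields*, Thm 7.5.10.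
-/

namespace Literature.GroupTheory.SpecificGroups

namespace PadicAffine

open Literature.AnabelianGeometry.AbsoluteAnabelian

variable {p : ℕ} [Fact p.Prime]

/-- Every subgroup containing the unit translation `(1, 1)` contains all translations `(m, 1)`,
`m ∈ ℕ` (`(m + 1, 1) = (m, 1) · (1, 1)`). [cite: MochizukiSemiAnbd2006, §0 p.6] -/
theorem transl_natCast_mem (S : Subgroup (PadicAffine p)) (h : (⟨1, 1⟩ : PadicAffine p) ∈ S)
    (m : ℕ) : (⟨(m : ℤ_[p]), 1⟩ : PadicAffine p) ∈ S := by
  induction m with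
  | zero =>
    have e : (⟨((0 : ℕ) : ℤ_[p]), 1⟩ : PadicAffine p) = 1 := by
      ext <;> simp
    rw [e]
    exact S.one_mem
  | succ m ih =>
    have e : (⟨((m + 1 : ℕ) : ℤ_[p]), 1⟩ : PadicAffine p) = ⟨(m : ℤ_[p]), 1⟩ * ⟨1, 1⟩ := by
      ext <;> simp
    rw [e]
    exact S.mul_mem ih h

/-- Every subgroup containing the homothety `(0, v)` contains the homotheties `(0, v ^ k)`,
`k ∈ ℕ` (`(0, v ^ (k + 1)) = (0, v ^ k) · (0, v)`). [cite: MochizukiSemiAnbd2006, §0 p.6] -/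
theorem homoth_pow_mem (S : Subgroup (PadicAffine p)) (v : ℤ_[p]ˣ)
    (h : (⟨0, v⟩ : PadicAffine p) ∈ S) (k : ℕ) : (⟨0, v ^ k⟩ : PadicAffine p) ∈ S := by
  induction k with
  | zero =>
    have e : (⟨0, v ^ 0⟩ : PadicAffine p) = 1 := by
      ext <;> simp
    rw [e]
    exact S.one_mem
  | succ k ih =>
    have e : (⟨0, v ^ (k + 1)⟩ : PadicAffine p) = ⟨0, v ^ k⟩ * ⟨0, v⟩ := by
      ext <;> simp [pow_succ]
    rw [e]
    exact S.mul_mem ih h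

/-- Modulo the congruence level `Γ_n` (`n ≥ 1`, `p` odd), `Aff(ℤ_p)` is generated by the
translation `(1, 1)` and a homothety `(0, v)` with `v ∈ ℤ_pˣ` lifting a generator of the cyclic
group `(ℤ/pⁿ)ˣ`: `closure {(1, 1), (0, v)} ⊔ Γ_n = ⊤`. [cite: MochizukiSemiAnbd2006, §0 p.6] -/
theorem exists_closure_pair_sup_level_eq_top (hp2 : p ≠ 2) {n : ℕ} (hn : 0 < n) :
    ∃ x : Fin 2 → PadicAffine p, Subgroup.closure (Set.range x) ⊔ level p n = ⊤ := by
  classical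
  -- a generator of the cyclic group `(ℤ/pⁿ)ˣ`, lifted to `ℤ_pˣ`
  haveI : IsCyclic (ZMod (p ^ n))ˣ := ZMod.isCyclic_units_of_prime_pow p Fact.out hp2 n
  obtain ⟨g, hg⟩ := IsCyclic.exists_monoid_generator (α := (ZMod (p ^ n))ˣ)
  obtain ⟨v, hv⟩ := Literature.GroupTheory.Index.GL2.unitsMap_toZModPow_surjective (p := p) hn g
  refine ⟨![⟨1, 1⟩, ⟨0, v⟩], ?_⟩
  rw [eq_top_iff]
  rintro y -
  set S : Subgroup (PadicAffine p) := Subgroup.closure (Set.range ![(⟨1, 1⟩ : PadicAffine p), ⟨0, v⟩])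
  have h1 : (⟨1, 1⟩ : PadicAffine p) ∈ S := Subgroup.subset_closure ⟨0, rfl⟩
  have h2 : (⟨0, v⟩ : PadicAffine p) ∈ S := Subgroup.subset_closure ⟨1, rfl⟩
  -- the exponent `k` with `g ^ k = (y.u mod pⁿ)` and the residue `m = (y.a mod pⁿ) ∈ ℕ`
  obtain ⟨k, hk⟩ := (Submonoid.mem_powers_iff _ _).mp
    (hg (Units.map (PadicInt.toZModPow (p := p) n).toMonoidHom y.u))
  set m : ℕ := (PadicInt.toZModPow n y.a).val
  -- the approximant `s = (m, 1) · (0, v ^ k) = (m, v ^ k)` lies in `S`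
  have hs : (⟨(m : ℤ_[p]), 1⟩ * ⟨0, v ^ k⟩ : PadicAffine p) ∈ S :=
    S.mul_mem (transl_natCast_mem S h1 m) (homoth_pow_mem S v h2 k)
  -- and agrees with `y` modulo `pⁿ`
  have hu : PadicInt.toZModPow n ((v : ℤ_[p]) ^ k) = PadicInt.toZModPow n (y.u : ℤ_[p]) := by
    have e1 : PadicInt.toZModPow n (v : ℤ_[p]) = ((g : (ZMod (p ^ n))ˣ) : ZMod (p ^ n)) := by
      rw [← hv]; rfl
    have e2 : ((g ^ k : (ZMod (p ^ n))ˣ) : ZMod (p ^ n)) = PadicInt.toZModPow n (y.u : ℤ_[p]) := by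
      rw [hk]; rfl
    rw [map_pow, e1, ← Units.val_pow_eq_pow_val, e2]
  have hred : red n (⟨(m : ℤ_[p]), 1⟩ * ⟨0, v ^ k⟩ : PadicAffine p) = red n y := by
    simp only [red, mul_a, mul_u, Units.val_one, one_mul, mul_zero, add_zero,
      Units.val_pow_eq_pow_val, hu, map_natCast, m, ZMod.natCast_zmod_val]
  have hmem := (inv_mul_mem_level_iff n _ y).mpr hred
  have ey : y = (⟨(m : ℤ_[p]), 1⟩ * ⟨0, v ^ k⟩ : PadicAffine p) *
      ((⟨(m : ℤ_[p]), 1⟩ * ⟨0, v ^ k⟩ : PadicAffine p)⁻¹ * y) := by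
    rw [mul_inv_cancel_left]
  rw [ey]
  exact Subgroup.mul_mem_sup hs hmem

/-- **`Aff(ℤ_p)` is topologically finitely generated for odd `p`** — indeed topologically
generated by two elements: every open normal subgroup contains a congruence level `Γ_n`
(`exists_level_le`), modulo which the translation `(1, 1)` and a suitable homothety generate
(`exists_closure_pair_sup_level_eq_top`); conclude by the reduction to finite quotients
[NSW 7.5.10] (`isTopologicallyFinitelyGenerated_of_forall_quotient`).  This is the finite-generation
input for running the [SemiAnbd] §5 tower statements at the Thm 3.7 model vertex group `Aff(ℤ_p)`.
[cite: MochizukiSemiAnbd2006, §0 p.6] -/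
theorem isTopologicallyFinitelyGenerated_padicAffine (hp2 : p ≠ 2) :
    IsTopologicallyFinitelyGenerated (PadicAffine p) := by
  refine isTopologicallyFinitelyGenerated_of_forall_quotient (D := 2) fun U _ hU => ?_
  obtain ⟨n, hn, hle⟩ := exists_level_le U hU
  obtain ⟨x, hx⟩ := exists_closure_pair_sup_level_eq_top (p := p) hp2 hn
  exact ⟨x, top_le_iff.mp (hx.ge.trans (sup_le_sup_left hle _))⟩

/-! ### All primes: transport of generation from `(ℤ/pⁿ)ˣ`, and the case `p = 2`

(v2, appended.)  The parity hypothesis of `isTopologicallyFinitelyGenerated_padicAffine` is removed: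
`PadicAffine.isTopologicallyFinitelyGenerated` below holds for every prime `p` (three topological
generators when `p = 2`: the translation `(1, 1)` and the homotheties `(0, -1)`, `(0, 5)`, since
`(ℤ/2ⁿ)ˣ = ⟨-1⟩ × ⟨5⟩`). -/

/-- The congruence levels decrease: `Γ_{n'} ≤ Γ_n` for `n ≤ n'`. [cite: MochizukiSemiAnbd2006, §0 p.6] -/
theorem level_antitone {n n' : ℕ} (h : n ≤ n') : level p n' ≤ level p n := by
  have hI : I p n' ≤ I p n := Ideal.span_singleton_le_span_singleton.mpr (pow_dvd_pow _ h)
  intro x hx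
  rw [mem_level_iff] at hx ⊢
  exact ⟨hI hx.1, hI hx.2⟩

/-- **Transport of generation from the units quotient**: if `T ⊆ ℤ_pˣ` is a set of units whose
reductions modulo `pⁿ` generate `(ℤ/pⁿ)ˣ`, then the translation `(1, 1)` together with the
homotheties `(0, v)`, `v ∈ T`, generate `Aff(ℤ_p)` modulo the congruence level `Γ_n`: modulo `Γ_n`
every `(a, u)` agrees with `(m, 1) · (0, w) = (m, w)`, `m ∈ ℕ` a residue of `a` and `w` a word in `T`
reducing to `u`. [cite: MochizukiSemiAnbd2006, §0 p.6] -/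
theorem closure_sup_level_eq_top_of_units (n : ℕ) (T : Set ℤ_[p]ˣ)
    (hT : Subgroup.closure ((Units.map (PadicInt.toZModPow (p := p) n).toMonoidHom) '' T) = ⊤) :
    Subgroup.closure ({(⟨1, 1⟩ : PadicAffine p)} ∪ (fun v : ℤ_[p]ˣ => (⟨0, v⟩ : PadicAffine p)) '' T)
      ⊔ level p n = ⊤ := by
  classical
  rw [eq_top_iff]
  rintro y -
  set S : Subgroup (PadicAffine p) :=
    Subgroup.closure ({(⟨1, 1⟩ : PadicAffine p)} ∪ (fun v : ℤ_[p]ˣ => (⟨0, v⟩ : PadicAffine p)) '' T)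
  have h1 : (⟨1, 1⟩ : PadicAffine p) ∈ S := Subgroup.subset_closure (Or.inl rfl)
  -- the homothety homomorphism `v ↦ (0, v)` maps `closure T` into `S`
  let η : ℤ_[p]ˣ →* PadicAffine p :=
    { toFun := fun v => ⟨0, v⟩
      map_one' := rfl
      map_mul' := fun v w => by ext <;> simp }
  have hη : (Subgroup.closure T).map η ≤ S := by
    rw [MonoidHom.map_closure]
    refine Subgroup.closure_mono ?_
    rintro _ ⟨v, hv, rfl⟩
    exact Or.inr ⟨v, hv, rfl⟩
  -- a word `w` in `T` reducing to `y.u mod pⁿ`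
  have hwy : Units.map (PadicInt.toZModPow (p := p) n).toMonoidHom y.u ∈
      (Subgroup.closure T).map (Units.map (PadicInt.toZModPow (p := p) n).toMonoidHom) := by
    rw [MonoidHom.map_closure, hT]
    exact Subgroup.mem_top _
  obtain ⟨w, hw, hwy⟩ := Subgroup.mem_map.mp hwy
  set m : ℕ := (PadicInt.toZModPow n y.a).val
  -- the approximant `(m, 1) · (0, w) = (m, w)` lies in `S` and agrees with `y` modulo `pⁿ`
  have hs : (⟨(m : ℤ_[p]), 1⟩ * ⟨0, w⟩ : PadicAffine p) ∈ S :=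
    S.mul_mem (transl_natCast_mem S h1 m) (hη ⟨w, hw, rfl⟩)
  have hu : PadicInt.toZModPow n (w : ℤ_[p]) = PadicInt.toZModPow n (y.u : ℤ_[p]) := by
    have := congrArg (fun u : (ZMod (p ^ n))ˣ => (u : ZMod (p ^ n))) hwy
    simpa using this
  have hred : red n (⟨(m : ℤ_[p]), 1⟩ * ⟨0, w⟩ : PadicAffine p) = red n y := by
    simp only [red, mul_a, mul_u, Units.val_one, one_mul, mul_zero, add_zero, hu, map_natCast, m,
      ZMod.natCast_zmod_val]
  have hmem := (inv_mul_mem_level_iff n _ y).mpr hred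
  rw [← mul_inv_cancel_left (⟨(m : ℤ_[p]), 1⟩ * ⟨0, w⟩ : PadicAffine p) y]
  exact Subgroup.mul_mem_sup hs hmem

/-- **`(ℤ/2^{m+2})ˣ` is generated by `-1` and `5`.**  `5` has order `2^m` (Mathlib
`ZMod.orderOf_five`), `-1 ∉ ⟨5⟩` (reduce modulo `4`: `5 ≡ 1`, `-1 ≢ 1`), and `#(ℤ/2^{m+2})ˣ = 2^{m+1}`,
so the subgroup `⟨-1, 5⟩ ⊋ ⟨5⟩` has order `2^{m+1}` ([Ireland–Rosen] Ch. 4 §1 Thm 2′: `U(ℤ/2^l ℤ) = {(-1)^a 5^b}`,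
`l ≥ 3`; the cases `l = 1, 2` are trivial and included). [cite: IrelandRosen1990, Ch.4 §1 Thm 2' p.43] -/
theorem closure_negOne_five_eq_top (m : ℕ) :
    Subgroup.closure ({-1, ZMod.unitOfCoprime 5 (Nat.Coprime.pow_right (m + 2) (by decide))} :
      Set (ZMod (2 ^ (m + 2)))ˣ) = ⊤ := by
  classical
  set five : (ZMod (2 ^ (m + 2)))ˣ := ZMod.unitOfCoprime 5 (Nat.Coprime.pow_right (m + 2) (by decide))
    with hfive
  set H : Subgroup (ZMod (2 ^ (m + 2)))ˣ := Subgroup.closure ({-1, five} : Set (ZMod (2 ^ (m + 2)))ˣ)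
  have hcard : Nat.card (ZMod (2 ^ (m + 2)))ˣ = 2 ^ (m + 1) := by
    rw [Nat.card_eq_fintype_card, ZMod.card_units_eq_totient, Nat.totient_prime_pow_succ Nat.prime_two]
    norm_num
  have h5 : orderOf five = 2 ^ m := by
    rw [← orderOf_units]
    exact ZMod.orderOf_five m
  have hzp : Subgroup.zpowers five ≤ H := by
    rw [Subgroup.zpowers_le]
    exact Subgroup.subset_closure (by simp)
  have hneg : (-1 : (ZMod (2 ^ (m + 2)))ˣ) ∈ H := Subgroup.subset_closure (by simp)
  -- `-1 ∉ ⟨5⟩`: reduce modulo `4`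
  have hnot : (-1 : (ZMod (2 ^ (m + 2)))ˣ) ∉ Subgroup.zpowers five := by
    intro hmem
    rw [← mem_powers_iff_mem_zpowers] at hmem
    obtain ⟨j, hj⟩ := hmem
    have h' : (5 : ZMod (2 ^ (m + 2))) ^ j = -1 := by
      have := congrArg (fun u : (ZMod (2 ^ (m + 2)))ˣ => (u : ZMod (2 ^ (m + 2)))) hj
      simpa [hfive] using this
    have hdvd : 4 ∣ 2 ^ (m + 2) := ⟨2 ^ m, by ring⟩
    have h4 := congrArg (ZMod.castHom hdvd (ZMod 4)) h'
    rw [map_pow, map_neg, map_one, map_ofNat, show (5 : ZMod 4) = 1 from by decide, one_pow] at h4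
    exact absurd h4 (by decide)
  -- counting: `#H` is a power of `2` between `2^m` (excluded) and `2^{m+1}`
  have hzcard : Nat.card (Subgroup.zpowers five) = 2 ^ m := by rw [Nat.card_zpowers, h5]
  obtain ⟨k, hk, hHk⟩ :=
    (Nat.dvd_prime_pow Nat.prime_two).mp (hcard ▸ Subgroup.card_subgroup_dvd_card H)
  have hmk : m ≤ k := by
    have hdvd : 2 ^ m ∣ 2 ^ k := by
      rw [← hzcard, ← hHk]
      exact Subgroup.card_dvd_of_le hzp
    exact (Nat.pow_dvd_pow_iff_le_right (by norm_num)).mp hdvd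
  have hne : k ≠ m := by
    intro hkm
    have hEq : Subgroup.zpowers five = H :=
      Subgroup.eq_of_le_of_card_ge hzp (by rw [hHk, hkm, hzcard])
    exact hnot (hEq ▸ hneg)
  have hk' : k = m + 1 := by omega
  exact Subgroup.eq_top_of_card_eq H (by rw [hHk, hk', hcard])

/-- Modulo `Γ_{m+2}` (`p = 2`), `Aff(ℤ_2)` is generated by the translation `(1, 1)` and the
homotheties `(0, -1)`, `(0, v)` with `v ∈ ℤ_2ˣ` lifting `5`: three generators suffice.
[cite: MochizukiSemiAnbd2006, §0 p.6] -/
theorem exists_closure_triple_sup_level_eq_top (hp : p = 2) (m : ℕ) :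
    ∃ x : Fin 3 → PadicAffine p, Subgroup.closure (Set.range x) ⊔ level p (m + 2) = ⊤ := by
  subst hp
  classical
  set f := (Units.map (PadicInt.toZModPow (p := 2) (m + 2)).toMonoidHom) with hf
  obtain ⟨v, hv⟩ := Literature.GroupTheory.Index.GL2.unitsMap_toZModPow_surjective (p := 2)
    (show 1 ≤ m + 2 by omega) (ZMod.unitOfCoprime 5 (Nat.Coprime.pow_right (m + 2) (by decide)))
  have hneg : f (-1) = -1 := by
    ext
    simp [hf]
  have hT : Subgroup.closure (f '' {-1, v}) = ⊤ := by
    rw [Set.image_pair, hneg, hv]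
    exact closure_negOne_five_eq_top m
  have h := closure_sup_level_eq_top_of_units (p := 2) (m + 2) {-1, v} hT
  refine ⟨![⟨1, 1⟩, ⟨0, -1⟩, ⟨0, v⟩], ?_⟩
  rw [eq_top_iff, ← h]
  refine sup_le_sup_right (Subgroup.closure_mono ?_) _
  rintro x (rfl | ⟨w, hw, rfl⟩)
  · exact ⟨0, rfl⟩
  · rcases hw with rfl | rfl
    · exact ⟨1, rfl⟩
    · exact ⟨2, rfl⟩

/-- **`Aff(ℤ_p)` is topologically finitely generated, for every prime `p`** (two topological
generators for odd `p`, three for `p = 2`): every open normal subgroup contains a congruence level,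
modulo which finitely many explicit elements generate (`exists_closure_pair_sup_level_eq_top`,
`exists_closure_triple_sup_level_eq_top`); conclude by the reduction to finite quotients
[NSW 7.5.10].  The finite-generation input ([AbsTopI] §0) for running the [SemiAnbd] §5 tower
statements at the Thm 3.7 model vertex group `Aff(ℤ_p)`. [cite: MochizukiSemiAnbd2006, §0 p.6] -/
theorem isTopologicallyFinitelyGenerated : IsTopologicallyFinitelyGenerated (PadicAffine p) := by
  by_cases hp2 : p = 2
  · refine isTopologicallyFinitelyGenerated_of_forall_quotient (D := 3) fun U _ hU => ?_
    obtain ⟨n, _, hle⟩ := exists_level_le U hU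
    obtain ⟨x, hx⟩ := exists_closure_triple_sup_level_eq_top (p := p) hp2 n
    exact ⟨x, top_le_iff.mp (hx.ge.trans
      (sup_le_sup_left ((level_antitone (p := p) (Nat.le_add_right n 2)).trans hle) _))⟩
  · exact isTopologicallyFinitelyGenerated_padicAffine hp2

end PadicAffine

end Literature.GroupTheory.SpecificGroups
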